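import Mathlib
import Summits.ABC.ABC.Theses.IneffectiveSubspace

/-!
# Stub `stub_ulGivesHallLang` of line `SketchIdeator5` (idea `cm-hall-lang-transfer`) — crux `IneffectiveSubspace.TowerFourSubLiouville` (stmt-ABC-1649)

UNIFORM LJUNGGREN ⟹ HALL–LANG for the CM family `y² = x³ + N·x` (a certificate: together with the
converse `stub_hallLangGivesUL`, the two targets of the card are one statement up to the exponent).

Hypothesis (uniform Ljunggren): there are `K, C` with `C > 0` such that every integer solution of
`x² − d·y⁴ = k` with `d` not a square and `k ≠ 0` has `|y| ≤ C·(|d|·|k|)^K`.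
Conclusion (Hall–Lang, `j = 1728`): there are `κ, C'` with `C' > 0` such that every integral point
`(x, y)` of `y² = x³ + N·x`, `N ≠ 0`, has `|x| ≤ C'·|N|^κ`.

Proof. Put `K₁ = max K 0`, `C₁ = max C 1`; answer with `κ = 2·K₁ + 1`, `C' = C₁²`. Let `Q = x² + N`,
so that `y² = x·Q`.
* If `Q ≤ 0` (forced when `x < 0`, because `x·Q = y² ≥ 0`), then `|x| ≤ x² ≤ −N = |N|`.
* If `x > 0` and `Q > 0`, write `x = d·m²` with `d` squarefree (`Nat.sq_mul_squarefree_of_pos`); from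
  `y² = m²·(d·Q)` we get `m ∣ y`, `(y/m)² = d·Q`, so `d ∣ y/m` (`Squarefree.dvd_pow_iff_dvd`) and
  `Q = d·n²`. Hence `N = Q − x² = d·(n² − d·m⁴)`.
  - `d = 1`: `N = n² − m⁴ ≠ 0` is a difference of two distinct squares, so `|N| ≥ 2·m² − 1 ≥ m² = x`.
  - `d ≠ 1`: `d` is squarefree, hence not a square, and `(n, m)` solves `n² − d·m⁴ = k` with
    `k = N/d ≠ 0`, `|d|·|k| = |N|`; uniform Ljunggren gives `m ≤ C·|N|^K ≤ C₁·|N|^{K₁}` (`|N| ≥ 1`),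
    and `d ≤ |N|` (`d ∣ N`), so `x = d·m² ≤ C₁²·|N|^{2·K₁+1}`.
In the cases ending with `|x| ≤ |N|` we finish by `|N| ≤ |N|^κ ≤ C₁²·|N|^κ` (`|N| ≥ 1`, `κ ≥ 1`, `C₁ ≥ 1`).
-/

-- `Summit.ABC.ABC` is the mandated summit-side namespace (CONVENTIONS §2); the duplicate is deliberate.
set_option linter.dupNamespace false

namespace Summit.ABC.ABC.Theorems.TowerFourSubLiouville

/-- If `x² + N ≤ 0` then `|x| ≤ |N|` (integers: `|x| ≤ x² ≤ −N ≤ |N|`). -/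
theorem ulGivesHallLang_abs_le_of_nonpos {N x : ℤ} (hQ : x ^ 2 + N ≤ 0) : |x| ≤ |N| := by
  have hx : |x| ≤ x ^ 2 := by
    rw [Int.abs_eq_natAbs]
    exact Int.natAbs_le_self_sq x
  calc |x| ≤ x ^ 2 := hx
    _ ≤ -N := by linarith
    _ ≤ |N| := neg_le_abs N

/-- An integral point of `y² = x³ + N·x` with `x < 0` has `x² + N ≤ 0`, because `x·(x² + N) = y² ≥ 0`. -/
theorem ulGivesHallLang_nonpos_of_neg {N x y : ℤ} (hx : x < 0) (h : y ^ 2 = x ^ 3 + N * x) :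
    x ^ 2 + N ≤ 0 := by
  by_contra hQ
  push Not at hQ
  have h1 : x * (x ^ 2 + N) < 0 := mul_neg_of_neg_of_pos hx hQ
  nlinarith [sq_nonneg y, h1, h]

/-- DESCENT: an integral point of `y² = x³ + N·x` with `x > 0` has `x = d·m²` and `x² + N = d·n²` for
some squarefree `d > 0`, `m > 0` and `n` (squarefree part of `x`; then `m ∣ y`, `(y/m)² = d·(x² + N)`,
and `d ∣ y/m` as `d` is squarefree). -/
theorem ulGivesHallLang_descent {N x y : ℤ} (hx : 0 < x) (h : y ^ 2 = x ^ 3 + N * x) :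
    ∃ d m n : ℤ, 0 < d ∧ 0 < m ∧ Squarefree d ∧ x = d * m ^ 2 ∧ x ^ 2 + N = d * n ^ 2 := by
  obtain ⟨a, b, ha, hb, hab, hsq⟩ := Nat.sq_mul_squarefree_of_pos (Int.natAbs_pos.mpr hx.ne')
  have hxab : x = (a : ℤ) * (b : ℤ) ^ 2 := by
    rw [← Int.natAbs_of_nonneg hx.le, ← hab]
    push_cast
    ring
  have hsqZ : Squarefree (a : ℤ) := Int.squarefree_natCast.mpr hsq
  have hb0 : (b : ℤ) ≠ 0 := by exact_mod_cast hb.ne'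
  have ha0 : (a : ℤ) ≠ 0 := by exact_mod_cast ha.ne'
  have hyQ : y ^ 2 = (b : ℤ) ^ 2 * ((a : ℤ) * (x ^ 2 + N)) := by
    rw [h, hxab]
    ring
  obtain ⟨y₁, hy₁⟩ : (b : ℤ) ∣ y := (Int.pow_dvd_pow_iff two_ne_zero).mp (Dvd.intro _ hyQ.symm)
  have h1 : y₁ ^ 2 = (a : ℤ) * (x ^ 2 + N) := by
    have h2 : (b : ℤ) ^ 2 * y₁ ^ 2 = (b : ℤ) ^ 2 * ((a : ℤ) * (x ^ 2 + N)) := by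
      rw [← hyQ, hy₁]
      ring
    exact mul_left_cancel₀ (pow_ne_zero 2 hb0) h2
  obtain ⟨n, hn⟩ : (a : ℤ) ∣ y₁ := (hsqZ.dvd_pow_iff_dvd two_ne_zero).mp (Dvd.intro _ h1.symm)
  refine ⟨a, b, n, by exact_mod_cast ha, by exact_mod_cast hb, hsqZ, hxab, ?_⟩
  have h3 : (a : ℤ) * (x ^ 2 + N) = (a : ℤ) * ((a : ℤ) * n ^ 2) := by
    rw [← h1, hn]
    ring
  exact mul_left_cancel₀ ha0 h3

/-- A squarefree integer other than `1` is not a square (`d = r·r` squarefree forces `r = ±1`). -/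
theorem ulGivesHallLang_not_isSquare {d : ℤ} (hd : Squarefree d) (hd1 : d ≠ 1) : ¬ IsSquare d := by
  rintro ⟨r, hr⟩
  have hu : IsUnit r := hd r ⟨1, by rw [mul_one]; exact hr⟩
  rcases Int.isUnit_iff.mp hu with rfl | rfl <;> exact hd1 (by rw [hr]; norm_num)

/-- SQUARE CORNER: if `(m²)² + N = n²` with `N ≠ 0`, then `m² ≤ |N|` (two distinct squares `n²`, `m⁴`
differ by at least `2·m² − 1 ≥ m²`). -/
theorem ulGivesHallLang_square_case {N m n : ℤ} (hN : N ≠ 0) (h : (m ^ 2) ^ 2 + N = n ^ 2) :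
    m ^ 2 ≤ |N| := by
  have ha : |n| ^ 2 = n ^ 2 := sq_abs n
  have ha0 : 0 ≤ |n| := abs_nonneg n
  have hm0 : 0 ≤ m ^ 2 := sq_nonneg m
  rcases lt_trichotomy |n| (m ^ 2) with hlt | heq | hgt
  · have h1 : |n| + 1 ≤ m ^ 2 := hlt
    have h2 : |n| ^ 2 ≤ (m ^ 2 - 1) ^ 2 := pow_le_pow_left₀ ha0 (by linarith) 2
    calc m ^ 2 ≤ -N := by nlinarith [h, ha, h1, h2, ha0]
      _ ≤ |N| := neg_le_abs N
  · exfalso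
    apply hN
    rw [← ha, heq] at h
    linarith
  · have h1 : m ^ 2 + 1 ≤ |n| := hgt
    have h2 : (m ^ 2 + 1) ^ 2 ≤ |n| ^ 2 := pow_le_pow_left₀ (by positivity) h1 2
    calc m ^ 2 ≤ N := by nlinarith [h, ha, h2, hm0]
      _ ≤ |N| := le_abs_self N

/-- INTEGER CORE: an integral point of `y² = x³ + N·x`, `N ≠ 0`, has `|x| ≤ |N|`, unless the descent
produces a solution `(n, m)` of a norm-form equation `n² − d·m⁴ = k` with `d > 0` not a square,
`k ≠ 0`, `x = d·m²`, `m > 0` and `N = d·k`. -/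
theorem ulGivesHallLang_dichotomy {N x y : ℤ} (hN : N ≠ 0) (h : y ^ 2 = x ^ 3 + N * x) :
    |x| ≤ |N| ∨ ∃ d m n : ℤ, 0 < d ∧ 0 < m ∧ ¬ IsSquare d ∧ x = d * m ^ 2 ∧
      n ^ 2 - d * m ^ 4 ≠ 0 ∧ N = d * (n ^ 2 - d * m ^ 4) := by
  by_cases hQ : x ^ 2 + N ≤ 0
  · exact Or.inl (ulGivesHallLang_abs_le_of_nonpos hQ)
  push Not at hQ
  rcases lt_trichotomy x 0 with hx | rfl | hx
  · exact absurd (ulGivesHallLang_nonpos_of_neg hx h) (not_le.mpr hQ)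
  · exact Or.inl (by rw [abs_zero]; exact abs_nonneg N)
  obtain ⟨d, m, n, hd, hm, hsq, hxdm, hQdn⟩ := ulGivesHallLang_descent hx h
  have hNd : N = d * (n ^ 2 - d * m ^ 4) := by
    rw [hxdm] at hQdn
    linear_combination hQdn
  by_cases hd1 : d = 1
  · left
    subst hd1
    rw [one_mul] at hxdm hQdn
    rw [hxdm] at hQdn ⊢
    rw [abs_of_nonneg (sq_nonneg m)]
    exact ulGivesHallLang_square_case hN hQdn
  · right
    refine ⟨d, m, n, hd, hm, ulGivesHallLang_not_isSquare hsq hd1, hxdm, ?_, hNd⟩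
    intro hk
    rw [hk, mul_zero] at hNd
    exact hN hNd

/-- ANALYTIC STEP: `|x| ≤ |N|` (integers, `N ≠ 0`) gives `|x| ≤ C'·|N|^κ` in `ℝ` whenever `κ ≥ 1` and
`C' ≥ 1`, since `|N| ≥ 1`. -/
theorem ulGivesHallLang_bound_of_abs_le {N x : ℤ} (hN : N ≠ 0) (hle : |x| ≤ |N|) {κ C' : ℝ}
    (hκ : 1 ≤ κ) (hC' : 1 ≤ C') : |(x : ℝ)| ≤ C' * |(N : ℝ)| ^ κ := by
  have hA1 : (1 : ℝ) ≤ |(N : ℝ)| := by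
    rw [← Int.cast_abs]
    exact_mod_cast Int.one_le_abs hN
  have h1 : |(x : ℝ)| ≤ |(N : ℝ)| := by
    rw [← Int.cast_abs, ← Int.cast_abs]
    exact_mod_cast hle
  calc |(x : ℝ)| ≤ |(N : ℝ)| := h1
    _ = |(N : ℝ)| ^ (1 : ℝ) := (Real.rpow_one _).symm
    _ ≤ |(N : ℝ)| ^ κ := Real.rpow_le_rpow_of_exponent_le hA1 hκ
    _ ≤ C' * |(N : ℝ)| ^ κ := le_mul_of_one_le_left (Real.rpow_nonneg (abs_nonneg _) κ) hC'

/-- **Uniform Ljunggren ⟹ Hall–Lang** (curried form): with `K₁ = max K 0` and `C₁ = max C 1`, every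
integral point of `y² = x³ + N·x`, `N ≠ 0`, has `|x| ≤ C₁²·|N|^(2·K₁+1)`. -/
theorem ulGivesHallLang_core {K C : ℝ} (hC : 0 < C)
    (hUL : ∀ d k x y : ℤ, ¬ IsSquare d → k ≠ 0 → x ^ 2 - d * y ^ 4 = k →
      (|y| : ℝ) ≤ C * ((|d| * |k| : ℤ) : ℝ) ^ K) :
    ∀ N x y : ℤ, N ≠ 0 → y ^ 2 = x ^ 3 + N * x →
      (|x| : ℝ) ≤ (max C 1) ^ 2 * (|N| : ℝ) ^ (2 * max K 0 + 1) := by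
  intro N x y hN h
  set K₁ : ℝ := max K 0 with hK₁
  set C₁ : ℝ := max C 1 with hC₁
  have hK₁0 : 0 ≤ K₁ := le_max_right K 0
  have hC₁1 : 1 ≤ C₁ := le_max_right C 1
  have hκ1 : (1 : ℝ) ≤ 2 * K₁ + 1 := by linarith
  have hC₁sq : (1 : ℝ) ≤ C₁ ^ 2 := one_le_pow₀ hC₁1
  rcases ulGivesHallLang_dichotomy hN h with hle | ⟨d, m, n, hd, _hm, hns, hxdm, hk, hNdk⟩
  · exact ulGivesHallLang_bound_of_abs_le hN hle hκ1 hC₁sq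
  -- generic case: apply uniform Ljunggren to the solution `(n, m)` of `n² − d·m⁴ = N/d`
  set A : ℝ := |(N : ℝ)| with hA
  have hA1 : 1 ≤ A := by
    rw [hA, ← Int.cast_abs]
    exact_mod_cast Int.one_le_abs hN
  have hA0 : 0 < A := lt_of_lt_of_le one_pos hA1
  have hbase : ((|d| * |n ^ 2 - d * m ^ 4| : ℤ) : ℝ) = A := by
    rw [hA, ← abs_mul, ← hNdk, Int.cast_abs]
  have hmB : |(m : ℝ)| ≤ C₁ * A ^ K₁ := by
    have h1 := hUL d (n ^ 2 - d * m ^ 4) n m hns hk rfl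
    rw [hbase] at h1
    calc |(m : ℝ)| ≤ C * A ^ K := h1
      _ ≤ C₁ * A ^ K₁ :=
          mul_le_mul (le_max_left C 1) (Real.rpow_le_rpow_of_exponent_le hA1 (le_max_left K 0))
            (Real.rpow_nonneg hA0.le K) (hC.le.trans (le_max_left C 1))
  have hdA : (d : ℝ) ≤ A := by
    have hdN : d ≤ |N| :=
      Int.le_of_dvd (abs_pos.mpr hN) ((dvd_abs d N).mpr (Dvd.intro _ hNdk.symm))
    rw [hA, ← Int.cast_abs]
    exact_mod_cast hdN
  have hexp : A ^ (2 * K₁ + 1) = A ^ K₁ * A ^ K₁ * A := by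
    rw [two_mul, Real.rpow_add hA0, Real.rpow_add hA0, Real.rpow_one]
  have hd0 : (0 : ℝ) < d := by exact_mod_cast hd
  calc |(x : ℝ)| = (d : ℝ) * |(m : ℝ)| ^ 2 := by
        rw [hxdm, Int.cast_mul, Int.cast_pow, abs_mul, abs_pow, abs_of_pos hd0]
    _ ≤ A * (C₁ * A ^ K₁) ^ 2 :=
        mul_le_mul hdA (pow_le_pow_left₀ (abs_nonneg _) hmB 2) (by positivity) hA0.le
    _ = C₁ ^ 2 * (A ^ K₁ * A ^ K₁ * A) := by ring
    _ = C₁ ^ 2 * A ^ (2 * K₁ + 1) := by rw [hexp]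

/-- Certificate of line `SketchIdeator5`, registered form: UNIFORM LJUNGGREN (every integer solution of
`x² − d·y⁴ = k`, `d` non-square, `k ≠ 0`, has `|y| ≤ C·(|d|·|k|)^K`) implies HALL–LANG for
`y² = x³ + N·x` (every integral point, `N ≠ 0`, has `|x| ≤ C'·|N|^κ`), with `κ = 2·max K 0 + 1` and
`C' = (max C 1)²`. -/
theorem stub_ulGivesHallLang : (∃ K C : ℝ, 0 < C ∧ ∀ d k x y : ℤ, ¬ IsSquare d → k ≠ 0 → x ^ 2 - d * y ^ 4 = k → (|y| : ℝ) ≤ C * ((|d| * |k| : ℤ) : ℝ) ^ K) → ∃ κ C : ℝ, 0 < C ∧ ∀ N x y : ℤ, N ≠ 0 → y ^ 2 = x ^ 3 + N * x → (|x| : ℝ) ≤ C * (|N| : ℝ) ^ κ :=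
  fun ⟨K, C, hC, hUL⟩ =>
    ⟨2 * max K 0 + 1, (max C 1) ^ 2, pow_pos (lt_of_lt_of_le one_pos (le_max_right C 1)) 2,
      ulGivesHallLang_core hC hUL⟩

end Summit.ABC.ABC.Theorems.TowerFourSubLiouville
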